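import Summits.QuantumFields.QCD.Theorems.WindowExtinction.Negative.SpectralFlowLocal

/-!
# The norm gap passes to a Schur complement (sub-goal `norm_gap_schur_complement` of crux stmt-QuantumFields-8967)

Deterministic lemma of the modular cell–wall template (crux idea `Cruxes/TipPricing/Ideas/modular-cell-wall-template.md`, lead c2;
serves stub `stub_spreadOfCells` of line `hermitian-flow-coarea` r3 for crux `TipPricing`): if a block matrix `H = [[A, B],[C, D]]`
with invertible pivot `D` has the norm gap `g²‖v‖² ≤ ‖H v‖²`, then so does its Schur complement `S = A − B D⁻¹ C`:
`g²‖u‖² ≤ ‖S u‖²` — test `H` on `v = (u, −D⁻¹ C u)`, whose image is `(S u, 0)`.  In the template this transfers the certified gap of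
the cell-with-collar block (CellLemma) to the dressed cell operator `K = H_cell − C H_collar⁻¹ Cᴴ` that the inertia gluing
(`negRootCount_eq_sum_of_blocks`) consumes.  Supports stmt-QuantumFields-8967 (helper; closes no item).
-/

namespace Summit.QuantumFields.QCD.Cruxes.TipPricing.ModularTemplate

open Matrix
open scoped BigOperators

/-- **The norm gap passes to the Schur complement.**  For `H = fromBlocks A B C D` with `D` invertible and
`g² Σ‖v‖² ≤ Σ‖(H v)‖²` for all `v`, the Schur complement `A − B D⁻¹ C` satisfies `g² Σ‖u‖² ≤ Σ‖((A − B D⁻¹ C) u)‖²`. [folklore] -/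
theorem norm_gap_schur_complement {m n : Type*} [Fintype m] [Fintype n] [DecidableEq m] [DecidableEq n]
    (A : Matrix m m ℂ) (B : Matrix m n ℂ) (C : Matrix n m ℂ) (D : Matrix n n ℂ) (hD : IsUnit D.det) {g : ℝ}
    (hgap : ∀ v : m ⊕ n → ℂ, g ^ 2 * ∑ i, ‖v i‖ ^ 2 ≤ ∑ i, ‖(Matrix.fromBlocks A B C D *ᵥ v) i‖ ^ 2) (u : m → ℂ) :
    g ^ 2 * ∑ i, ‖u i‖ ^ 2 ≤ ∑ i, ‖((A - B * D⁻¹ * C) *ᵥ u) i‖ ^ 2 := by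
  -- the test vector `v = (u, -D⁻¹ C u)`
  set w : n → ℂ := -(D⁻¹ *ᵥ (C *ᵥ u)) with hw
  set v : m ⊕ n → ℂ := Sum.elim u w with hv
  have hHv : Matrix.fromBlocks A B C D *ᵥ v = Sum.elim ((A - B * D⁻¹ * C) *ᵥ u) 0 := by
    rw [hv, Matrix.fromBlocks_mulVec, Sum.elim_comp_inl, Sum.elim_comp_inr]
    congr 1
    · rw [hw, Matrix.mulVec_neg, Matrix.sub_mulVec, Matrix.mulVec_mulVec, Matrix.mulVec_mulVec, sub_eq_add_neg]
    · rw [hw, Matrix.mulVec_neg, Matrix.mulVec_mulVec, Matrix.mul_nonsing_inv _ hD, Matrix.one_mulVec, add_neg_cancel]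
  have key := hgap v
  rw [hHv] at key
  have h1 : ∑ i, ‖v i‖ ^ 2 = ∑ i, ‖u i‖ ^ 2 + ∑ j, ‖w j‖ ^ 2 := by
    rw [Fintype.sum_sum_type]; rfl
  have h2 : ∑ i, ‖(Sum.elim ((A - B * D⁻¹ * C) *ᵥ u) (0 : n → ℂ)) i‖ ^ 2 = ∑ i, ‖((A - B * D⁻¹ * C) *ᵥ u) i‖ ^ 2 := by
    rw [Fintype.sum_sum_type]
    simp
  rw [h1, h2] at key
  have h3 : 0 ≤ g ^ 2 * ∑ j, ‖w j‖ ^ 2 := mul_nonneg (sq_nonneg g) (Finset.sum_nonneg fun j _ => by positivity)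
  nlinarith

end Summit.QuantumFields.QCD.Cruxes.TipPricing.ModularTemplate
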